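import Literature.AlgebraicGeometry.Resolution.BlowupRingExceptionalFibre
import HarnessLib

/-!
# The `x_i`-chart of the blow-up of a regular local subring at its closed point: the exceptional fibre
# is an affine space WITH ITS COORDINATES `T_j ↦ x_j/x_i`

Route-independent commutative algebra, a sharpening of `blowupRing_chartQuotient`
(`BlowupRingExceptionalFibre.lean`, Stacks 0BIQ): for a regular system of parameters `x` of the regular local
subring `S ⊆ K` and `x_i ≠ 0`, the isomorphism `ψ : κ(S)[T_j : j ≠ i] ≅ S[𝔪/x_i]/(x_i)` is compatible with
`S → S[𝔪/x_i]` AND sends the variable `T_j` to the class of the fraction `x_j/x_i` — the second clause is how the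
printed statement reads («`(R/I)[y_j]` modulo `a`, `a y_j = a_j`») and is what identifies the class of a strict
transform `F(x)/x_i^d` modulo `x_i` with the dehomogenised form `F(1, T)`; the tree's `blowupRing_chartQuotient`
constructs exactly this `ψ` but records only its bijectivity and its values on constants. The proof is that of
`blowupRing_chartQuotient` verbatim, with the value on `T_j` read off the presentation
(`blowupAlgebra.eval_X`, `blowupAlgebra.coe_frac`). No definitions.

* `blowupRing_chartQuotient_X` — `∃ ψ`, bijective, `ψ (C s̄) = [s]`, `ψ (T_j) = [x_j/x_i]`.

References: Stacks Project Tag 0BIQ (More on Algebra, Lemma 32.2) [StacksProject]; H. Matsumura, *Commutative Ring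
Theory* (1986), Thm. 17.10 [Matsumura1987]. -/

noncomputable section

open IsLocalRing

namespace Literature.AlgebraicGeometry.Resolution

universe u

variable {K : Type u} [Field K]

/-- **The exceptional fibre of the chart is an affine space, with coordinates** (Stacks 0BIQ for the regular system
of parameters `x` of the regular local subring `S ⊆ K`): there is a ring isomorphism
`ψ : κ(S)[T_j : j ≠ i] ≅ S[𝔪/x_i]/(x_i)` with `ψ (C s̄) = [s]` for `s ∈ S` and `ψ (T_j) = [x_j/x_i]` for `j ≠ i`
(for any witness of `x_j/x_i ∈ S[𝔪/x_i]`, e.g. `div_mem_blowupRing`). The affine blow-up algebra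
`S[𝔪/x_i] ⊆ S[1/x_i]` (`blowupAlgebra`) maps isomorphically onto `blowupRing S x_i ⊆ K`, `frac_j ↦ x_j/x_i`; modulo
`x_i` its presentation `S[T_j : j ≠ i] → S[𝔪/x_i]`, `T_j ↦ frac_j`, has kernel `𝔪 · S[T]`
(`blowupAlgebra.comap_eval_span_algebraMap_eq`, quasi-regularity of `x`, Matsumura Thm. 17.10), the kernel of
`S[T] → κ(S)[T]`. [cite: StacksProject, Tag 0BIQ] -/
theorem blowupRing_chartQuotient_X (S : Subring K) [IsRegularLocalRing S] {d : ℕ}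
    (hd : (maximalIdeal S).spanFinrank = d) (x : Fin d → S)
    (hx : Ideal.span (Set.range x) = maximalIdeal S) (i : Fin d) (hxi : x i ≠ 0) :
    ∃ ψ : MvPolynomial {j : Fin d // j ≠ i} (ResidueField S) →+*
        blowupRing S (x i : K) ⧸
          Ideal.span {(⟨(x i : K), le_blowupRing S (x i : K) (x i).2⟩ : blowupRing S (x i : K))},
      Function.Bijective ψ ∧
      (∀ s : S, ψ (MvPolynomial.C (residue S s)) =
        Ideal.Quotient.mk _ ⟨(s : K), le_blowupRing S (x i : K) s.2⟩) ∧
      ∀ (j : {j : Fin d // j ≠ i}) (h : ((x j.1 : S) : K) / ((x i : S) : K) ∈ blowupRing S (x i : K)),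
        ψ (MvPolynomial.X j) = Ideal.Quotient.mk _ ⟨((x j.1 : S) : K) / ((x i : S) : K), h⟩ := by
  -- the proof of `blowupRing_chartQuotient` (BlowupRingExceptionalFibre.lean) verbatim, plus the value on `X j`
  classical
  have hxm : ∀ j, x j ∈ maximalIdeal S := fun j => hx ▸ Ideal.subset_span ⟨j, rfl⟩
  have hθ : ((x i : S) : K) ≠ 0 := fun h => hxi (Subtype.ext h)
  have hunit : IsUnit (S.subtype (x i)) := isUnit_iff_ne_zero.mpr hθ
  -- `Θ : S[1/x_i] → K` and `g : S[𝔪/x_i] → K`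
  let Θ : Localization.Away (x i) →+* K := IsLocalization.Away.lift (x i) hunit
  have hΘalg : ∀ s : S, Θ (algebraMap S (Localization.Away (x i)) s) = (s : K) := fun s =>
    IsLocalization.Away.lift_eq (x i) hunit s
  have hΘinv : Θ (IsLocalization.Away.invSelf (x i)) = ((x i : S) : K)⁻¹ := by
    apply eq_inv_of_mul_eq_one_left
    rw [← hΘalg (x i), ← map_mul, mul_comm, IsLocalization.Away.mul_invSelf, map_one]
  let g : blowupAlgebra (Ideal.span (Set.range x)) (x i) →+* K :=
    Θ.comp (blowupAlgebra (Ideal.span (Set.range x)) (x i)).val.toRingHom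
  have hgalg : ∀ s : S, g (algebraMap S (blowupAlgebra (Ideal.span (Set.range x)) (x i)) s) = (s : K) :=
    fun s => hΘalg s
  have hgfrac : ∀ j : Fin d, g (blowupAlgebra.frac x i j) = ((x j : S) : K) / ((x i : S) : K) := by
    intro j
    change Θ ((blowupAlgebra.frac x i j : Localization.Away (x i))) = _
    rw [blowupAlgebra.coe_frac, map_mul, hΘalg, hΘinv, div_eq_mul_inv]
  -- `g ∘ eval = eval₂ (x_j/x_i)`
  have hgeval : g.comp (blowupAlgebra.eval x i).toRingHom =
      MvPolynomial.eval₂Hom S.subtype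
        (fun j : {j : Fin d // j ≠ i} => ((x j.1 : S) : K) / ((x i : S) : K)) := by
    refine (blowupAlgebra.comp_val_comp_eval x i Θ).trans ?_
    congr 1
    · ext s
      exact hΘalg s
    · funext j
      exact hgfrac j.1
  have hgeval' : ∀ P, g (blowupAlgebra.eval x i P) = MvPolynomial.eval₂Hom S.subtype
      (fun j : {j : Fin d // j ≠ i} => ((x j.1 : S) : K) / ((x i : S) : K)) P := fun P => by
    rw [← hgeval]; rfl
  -- the range of `g` is `S[𝔪/x_i] ⊆ K`
  have heval_mem : ∀ P : MvPolynomial {j : Fin d // j ≠ i} S, MvPolynomial.eval₂Hom S.subtype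
      (fun j : {j : Fin d // j ≠ i} => ((x j.1 : S) : K) / ((x i : S) : K)) P ∈
        blowupRing S (x i : K) := by
    intro P
    induction P using MvPolynomial.induction_on with
    | C s =>
      rw [MvPolynomial.eval₂Hom_C]
      exact le_blowupRing S _ s.2
    | add p q hp hq =>
      rw [map_add]
      exact Subring.add_mem _ hp hq
    | mul_X p j hp =>
      rw [map_mul, MvPolynomial.eval₂Hom_X']
      exact Subring.mul_mem _ hp (div_mem_blowupRing _ (hxm j.1))
  have hrange : g.range = blowupRing S (x i : K) := by
    apply le_antisymm
    · rintro _ ⟨z, rfl⟩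
      obtain ⟨P, rfl⟩ := blowupAlgebra.eval_surjective x i z
      rw [hgeval']
      exact heval_mem P
    · rw [blowupRing_eq_closure_of_span_eq ((x i : S) : K) (Set.range x) hx, Subring.closure_le]
      rintro z (hz | ⟨y, ⟨j, rfl⟩, rfl⟩)
      · exact ⟨algebraMap S _ ⟨z, hz⟩, hgalg ⟨z, hz⟩⟩
      · exact ⟨blowupAlgebra.frac x i j, hgfrac j⟩
  -- `g` is injective
  have hΘinj : ∀ z, Θ z = 0 → z = 0 := by
    intro z hz
    obtain ⟨⟨r, s⟩, hrs⟩ := IsLocalization.surj (Submonoid.powers (x i)) z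
    have hr : (r : K) = 0 := by
      have h := congrArg Θ hrs
      rw [map_mul, hz, zero_mul, hΘalg] at h
      exact h.symm
    have hr0 : r = 0 := Subtype.ext hr
    rw [hr0, map_zero] at hrs
    exact (IsUnit.mul_left_eq_zero (IsLocalization.map_units _ s)).mp hrs
  have hginj : Function.Injective g := by
    intro a b h
    apply Subtype.ext
    have h0 : Θ ((a : Localization.Away (x i)) - b) = 0 := by
      rw [map_sub]
      exact sub_eq_zero.mpr h
    exact sub_eq_zero.mp (hΘinj _ h0)
  -- `e₁ : S[𝔪/x_i] ≃ blowupRing S x_i`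
  have hmem : ∀ b, g b ∈ blowupRing S (x i : K) := fun b => by rw [← hrange]; exact ⟨b, rfl⟩
  let g' : blowupAlgebra (Ideal.span (Set.range x)) (x i) →+* blowupRing S (x i : K) :=
    g.codRestrict _ hmem
  have hg' : Function.Bijective g' := by
    refine ⟨fun a b h => hginj (congrArg Subtype.val h), fun z => ?_⟩
    have hz : (z : K) ∈ g.range := by rw [hrange]; exact z.2
    obtain ⟨b, hb⟩ := hz
    exact ⟨b, Subtype.ext hb⟩
  let e₁ : blowupAlgebra (Ideal.span (Set.range x)) (x i) ≃+* blowupRing S (x i : K) :=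
    RingEquiv.ofBijective g' hg'
  have he₁alg : ∀ s : S, e₁ (algebraMap S (blowupAlgebra (Ideal.span (Set.range x)) (x i)) s) =
      ⟨(s : K), le_blowupRing S (x i : K) s.2⟩ :=
    fun s => Subtype.ext (hgalg s)
  -- the presentation modulo `x_i`: `S[T] → S[𝔪/x_i]/(x_i)` is onto with kernel `𝔪 · S[T]`
  let J : Ideal (blowupAlgebra (Ideal.span (Set.range x)) (x i)) :=
    Ideal.span {algebraMap S (blowupAlgebra (Ideal.span (Set.range x)) (x i)) (x i)}
  let π : MvPolynomial {j : Fin d // j ≠ i} S →+* blowupAlgebra (Ideal.span (Set.range x)) (x i) ⧸ J :=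
    (Ideal.Quotient.mk J).comp (blowupAlgebra.eval x i).toRingHom
  have hπsurj : Function.Surjective π :=
    Ideal.Quotient.mk_surjective.comp (blowupAlgebra.eval_surjective x i)
  have hπker : RingHom.ker π = Ideal.map MvPolynomial.C (Ideal.span (Set.range x)) := by
    change RingHom.ker ((Ideal.Quotient.mk J).comp _) = _
    rw [← RingHom.comap_ker, Ideal.mk_ker]
    exact blowupAlgebra.comap_eval_span_algebraMap_eq x i
      (isQuasiRegular_regularSystemOfParameters hd x hx)
  -- `S[T] → κ(S)[T]` is onto with the same kernel
  let σ : MvPolynomial {j : Fin d // j ≠ i} S →+* MvPolynomial {j : Fin d // j ≠ i} (ResidueField S) :=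
    MvPolynomial.map (residue S)
  have hσsurj : Function.Surjective σ := MvPolynomial.map_surjective _ residue_surjective
  have hσker : RingHom.ker σ = Ideal.map MvPolynomial.C (Ideal.span (Set.range x)) := by
    change RingHom.ker (MvPolynomial.map (residue S)) = _
    rw [MvPolynomial.ker_map, ker_residue, hx]
  -- hence `ψ' : κ(S)[T] → S[𝔪/x_i]/(x_i)`, a bijection
  let ψ' : MvPolynomial {j : Fin d // j ≠ i} (ResidueField S) →+*
      blowupAlgebra (Ideal.span (Set.range x)) (x i) ⧸ J :=
    σ.liftOfSurjective hσsurj ⟨π, by rw [hσker, hπker]⟩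
  have hψ'σ : ∀ P, ψ' (σ P) = π P := fun P =>
    σ.liftOfSurjective_comp_apply hσsurj ⟨π, by rw [hσker, hπker]⟩ P
  have hψ'bij : Function.Bijective ψ' := by
    constructor
    · refine (injective_iff_map_eq_zero ψ').mpr fun Q hQ => ?_
      obtain ⟨P, rfl⟩ := hσsurj Q
      rw [hψ'σ] at hQ
      have hP : P ∈ RingHom.ker σ := by rw [hσker, ← hπker]; exact hQ
      exact hP
    · intro z
      obtain ⟨P, rfl⟩ := hπsurj z
      exact ⟨σ P, hψ'σ P⟩
  -- transport `S[𝔪/x_i]/(x_i) ≅ blowupRing/(x_i)` along `e₁`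
  let J' : Ideal (blowupRing S (x i : K)) :=
    Ideal.span {(⟨(x i : K), le_blowupRing S (x i : K) (x i).2⟩ : blowupRing S (x i : K))}
  have hJJ' : J' = J.map (e₁ : blowupAlgebra (Ideal.span (Set.range x)) (x i) →+* blowupRing S (x i : K)) := by
    change Ideal.span _ = Ideal.map _ (Ideal.span _)
    rw [Ideal.map_span, Set.image_singleton]
    congr 2
    exact (he₁alg (x i)).symm
  let q : blowupAlgebra (Ideal.span (Set.range x)) (x i) ⧸ J ≃+* blowupRing S (x i : K) ⧸ J' :=
    Ideal.quotientEquiv J J' e₁ hJJ'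
  refine ⟨q.toRingHom.comp ψ', q.bijective.comp hψ'bij, fun s => ?_, fun j h => ?_⟩
  -- constants: `C s̄ ↦ [s/1] ↦ [s]`
  · have hσC : σ (MvPolynomial.C s) = MvPolynomial.C (residue S s) := MvPolynomial.map_C _ _
    change q (ψ' (MvPolynomial.C (residue S s))) = _
    rw [← hσC, hψ'σ]
    change q (Ideal.Quotient.mk J ((blowupAlgebra.eval x i) (MvPolynomial.C s))) = _
    rw [blowupAlgebra.eval_C, Ideal.quotientEquiv_mk]
    congr 1
    exact he₁alg s
  -- variables: `X j ↦ [frac_j] ↦ [x_j/x_i]`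
  · have hσX : σ (MvPolynomial.X j) = MvPolynomial.X j := MvPolynomial.map_X _ _
    change q (ψ' (MvPolynomial.X j)) = _
    rw [← hσX, hψ'σ]
    change q (Ideal.Quotient.mk J ((blowupAlgebra.eval x i) (MvPolynomial.X j))) = _
    rw [blowupAlgebra.eval_X, Ideal.quotientEquiv_mk]
    congr 1
    exact Subtype.ext (hgfrac j.1)

end Literature.AlgebraicGeometry.Resolution

end
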